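import Summits.PneNP.PneNP.Theorems.ChebyshevTracialDesignSplittingMatchings
import Summits.PneNP.PneNP.Theorems.ChebyshevTracialDesignCommonTightCut
import Summits.PneNP.PneNP.Theorems.ChebyshevTracialDesignDimensionOne
import HarnessLib

/-!
# Cell pnp-psdrank, route `ChebyshevTracialDesign`: EXACT rank-one tight labellings in dimension three are worth ONE tight rectangle
# (crux `TracialDecayExp20`, stmt-PneNP-19878)

Brick 76 (prover g13; MEMO-16 §5). The 'junk-free' case of the dense non-crossing psd cell at `r = 3`, with a DIFFUSE matching side allowed.
Let `u : t-cuts → S²`, `v : matchings → S²` be unit labels that are orthogonal on EVERY tight pair (`cc(U,M) = 1 ⇒ u_U ⊥ v_M` — an EXACT labelling: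
all pairs constrained, no activity pattern), and `x, y ∈ [0,1]` arbitrary weights (`x` supported on the `t`-cuts). Then for EVERY weight `W` whose tight
`[0,1]`-rectangles are bounded by `γ` (`TracialValueLEAt W γ 1`),
    `Σ_U Σ_M W(U,M) · x_U y_M ⟨u_U, v_M⟩² ≤ γ`                                                            (`exact_rankOne_dim_three_le`),
i.e. the rank-one psd strategy `X_U = x_U u_U u_Uᵀ`, `Y_M = y_M v_M v_Mᵀ` of dimension 3 is worth one tight rectangle — although the matching labels may
form a continuum (no net, no dictionary, no homogeneity, no (SNT-q)). Proof (MEMO-16 §5), all from the biclique skeleton: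
(1) if all `t`-cut labels are parallel, every `v_M` is orthogonal to the common line (each `M` has a tight `t`-cut), value `0`;
(2) otherwise two ADJACENT cuts `W + a`, `W + b` have independent labels (Johnson connectivity, brick 75), so every matching splitting along `W` is
    labelled by the normal `p = u_{W+a} × u_{W+b}` (link/biclique rigidity, brick 71), and since EVERY cut is tight with such a matching (brick 75
    `exists_split_tight_cut`) all cut labels lie in the plane `p^⊥` (PLANARITY);
(3) a matching with `v_M ∦ p` has all its tight cuts labelled by the line `v_M × p`; any two matchings share a tight cut (brick 74), so these lines
    coincide (`ℓ₀`) and EVERY `v_M ⊥ ℓ₀`;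
(4) with `u_U ⊥ p`, `v_M ⊥ ℓ₀`, `p ⊥ ℓ₀`: `⟨u_U, v_M⟩·|p| = ⟨u_U, m⟩⟨v_M, m⟩/|p|` for `m = p × ℓ₀` (a 3×3 Cauchy–Binet identity), so the kernel
    FACTORISES, `⟨u,v⟩² = f_U g_M` with `f, g ∈ [0,1]`, and `(x f, y g)` is a single tight `[0,1]`-rectangle.
§1 vector algebra in `ℝ³` (cross products); §2 the theorem. [cite: Rothvoss2017, §2 (PDF p. 6)] [cite: BrietDadushPokutta2014, Thm. 6 (§3)]
Stature: support/instrument — a TOY CASE: exactness (every tight pair constrained) is far from the dense cell, where labels are constrained only on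
`supp x × supp y`; it shows that at `r = 3` directional diffuseness ALONE is harmless and the difficulty is the activity pattern.
WHAT THIS IS NOT: nothing on the dense cell with junk, nothing on psd rank of P_PM(K_n), no P-vs-NP content.
-/

set_option linter.dupNamespace false -- `Summit.PneNP.PneNP.…`: summit = sub-problem (D-0017)

noncomputable section

namespace Summit.PneNP.PneNP.Theorems.ChebyshevTracialDesignExactDimThree

open Finset Matrix Literature.Barriers.PneNP Literature.Combinatorics.Optimization
open Literature.Combinatorics.AssociationSchemes.CutMatchingRestriction
open Summit.PneNP.PneNP.Theorems.ChebyshevTracialDesignTightLinks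
open Summit.PneNP.PneNP.Theorems.ChebyshevTracialDesignSplittingMatchings
open Summit.PneNP.PneNP.Theorems.ChebyshevTracialDesignCommonTightCut
open Summit.PneNP.PneNP.Theorems.ChebyshevTracialDesignDimensionOne
open scoped Matrix

/-! ### §1 Vector algebra in `ℝ³` -/

section Vec3

/-- **Parallel vectors**: if `w × p = 0` then `|p|² w = (w ⬝ p) p` and `(w ⬝ p)² = |w|² |p|²` (Lagrange's identity). -/
theorem smul_eq_smul_of_cross_eq_zero {w p : Fin 3 → ℝ} (h : w ⨯₃ p = 0) :
    (p ⬝ᵥ p) • w = (w ⬝ᵥ p) • p ∧ (w ⬝ᵥ p) ^ 2 = (w ⬝ᵥ w) * (p ⬝ᵥ p) := by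
  have hlag : (w ⬝ᵥ w) * (p ⬝ᵥ p) - (w ⬝ᵥ p) * (p ⬝ᵥ w) = 0 := by
    rw [← cross_dot_cross, h, zero_dotProduct]
  rw [dotProduct_comm p w] at hlag
  have hsq : (w ⬝ᵥ p) ^ 2 = (w ⬝ᵥ w) * (p ⬝ᵥ p) := by nlinarith [hlag]
  refine ⟨?_, hsq⟩
  -- `z = |p|² w − (w⬝p) p` has `z ⬝ z = 0`
  set z := (p ⬝ᵥ p) • w - (w ⬝ᵥ p) • p with hz
  have hzz : z ⬝ᵥ z = 0 := by
    rw [hz, sub_dotProduct, dotProduct_sub, dotProduct_sub, smul_dotProduct, dotProduct_smul, smul_dotProduct, dotProduct_smul,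
      smul_dotProduct, dotProduct_smul, smul_dotProduct, dotProduct_smul, dotProduct_comm p w]
    simp only [smul_eq_mul]
    linear_combination (-(p ⬝ᵥ p)) * hsq
  have hz0 : z = 0 := dotProduct_self_eq_zero.1 hzz
  rw [hz, sub_eq_zero] at hz0
  exact hz0

/-- A vector orthogonal to `a` and `b` has zero cross product with `a × b` (so it is parallel to it, `smul_eq_smul_of_cross_eq_zero`). -/
theorem cross_eq_zero_of_orth {a b w : Fin 3 → ℝ} (hwa : w ⬝ᵥ a = 0) (hwb : w ⬝ᵥ b = 0) : w ⨯₃ (a ⨯₃ b) = 0 := by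
  rw [cross_cross_eq_smul_sub_smul', hwb, dotProduct_comm, hwa, zero_smul, zero_smul, sub_zero]

/-- **The 3×3 Cauchy–Binet identity** `det[u;p;ℓ]·det[v;p;ℓ] = det(Gram)`, written with `m = p × ℓ`:
`(u⬝m)(v⬝m) = (u⬝v)((p⬝p)(ℓ⬝ℓ) − (p⬝ℓ)²) − (u⬝p)((p⬝v)(ℓ⬝ℓ) − (p⬝ℓ)(ℓ⬝v)) + (u⬝ℓ)((p⬝v)(p⬝ℓ) − (p⬝p)(ℓ⬝v))`. -/
theorem dot_cross_mul_dot_cross (u v p ℓ : Fin 3 → ℝ) :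
    (u ⬝ᵥ (p ⨯₃ ℓ)) * (v ⬝ᵥ (p ⨯₃ ℓ)) =
      (u ⬝ᵥ v) * ((p ⬝ᵥ p) * (ℓ ⬝ᵥ ℓ) - (p ⬝ᵥ ℓ) ^ 2) - (u ⬝ᵥ p) * ((p ⬝ᵥ v) * (ℓ ⬝ᵥ ℓ) - (p ⬝ᵥ ℓ) * (ℓ ⬝ᵥ v)) +
        (u ⬝ᵥ ℓ) * ((p ⬝ᵥ v) * (p ⬝ᵥ ℓ) - (p ⬝ᵥ p) * (ℓ ⬝ᵥ v)) := by
  simp only [cross_apply, vec3_dotProduct]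
  simp only [Matrix.cons_val_zero, Matrix.cons_val_one, Matrix.cons_val]
  ring

/-- **Factorisation of the kernel.** If `u ⊥ p`, `v ⊥ ℓ`, `p ⊥ ℓ`, then `(u ⬝ v)(p ⬝ p)(ℓ ⬝ ℓ) = (u ⬝ m)(v ⬝ m)` with `m = p × ℓ`. -/
theorem dot_mul_eq_of_orth {u v p ℓ : Fin 3 → ℝ} (hup : u ⬝ᵥ p = 0) (hvl : v ⬝ᵥ ℓ = 0) (hpl : p ⬝ᵥ ℓ = 0) :
    (u ⬝ᵥ v) * ((p ⬝ᵥ p) * (ℓ ⬝ᵥ ℓ)) = (u ⬝ᵥ (p ⨯₃ ℓ)) * (v ⬝ᵥ (p ⨯₃ ℓ)) := by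
  rw [dot_cross_mul_dot_cross, hup, hpl, dotProduct_comm ℓ v, hvl]
  ring

/-- Unit vectors with different projectors have a nonzero cross product: if `a ⬝ a = b ⬝ b = 1` and `vecMulVec a a ≠ vecMulVec b b` then
`(a × b) ⬝ (a × b) ≠ 0`. -/
theorem cross_dot_cross_ne_zero {a b : Fin 3 → ℝ} (ha : a ⬝ᵥ a = 1) (hb : b ⬝ᵥ b = 1) (hab : vecMulVec a a ≠ vecMulVec b b) :
    (a ⨯₃ b) ⬝ᵥ (a ⨯₃ b) ≠ 0 := by
  intro h0
  rw [cross_dot_cross, ha, hb, dotProduct_comm b a] at h0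
  -- `(a⬝b)² = 1`, so `b = (a⬝b) a`
  set c := a ⬝ᵥ b with hc
  have hc2 : c * c = 1 := by linarith
  set z := b - c • a with hz
  have hzz : z ⬝ᵥ z = 0 := by
    rw [hz, sub_dotProduct, dotProduct_sub, dotProduct_sub, smul_dotProduct, dotProduct_smul, smul_dotProduct, dotProduct_smul, hb, ha,
      dotProduct_comm b a, ← hc]
    simp only [smul_eq_mul]
    nlinarith [hc2]
  have hz0 : b = c • a := by rw [← sub_eq_zero]; exact dotProduct_self_eq_zero.1 hzz
  apply hab
  rw [hz0]
  ext i j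
  simp only [vecMulVec_apply, Pi.smul_apply, smul_eq_mul]
  calc a i * a j = (c * c) * (a i * a j) := by rw [hc2, one_mul]
    _ = c * a i * (c * a j) := by ring

/-- `(a ⬝ w)² = w ⬝ (a aᵀ w)`: orthogonality to `a` depends only on the projector `a aᵀ`. -/
theorem dot_sq_eq_vecMulVec (a w : Fin 3 → ℝ) : (a ⬝ᵥ w) ^ 2 = w ⬝ᵥ (vecMulVec a a *ᵥ w) := by
  rw [vecMulVec_mulVec, dotProduct_smul, MulOpposite.smul_eq_mul_unop, MulOpposite.unop_op, dotProduct_comm w a, sq]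

end Vec3

/-! ### §2 The exact theorem -/

section Exact

variable {n : ℕ}

/-- Every perfect matching has a tight `t`-cut, for every odd `t ≤ n − 1` (brick 74 with `M' = M`). -/
theorem exists_tight_cut {t : ℕ} (ht : Odd t) (htn : t + 1 ≤ n) (M : PMatch n) : ∃ U : OddSet n, U.1.card = t ∧ cc U M = 1 := by
  obtain ⟨U, hU, h, -⟩ := exists_common_tight_cut ht htn M M
  exact ⟨U, hU, h⟩

/-- **EXACT RANK-ONE TIGHT LABELLINGS IN `ℝ³` ARE WORTH ONE TIGHT RECTANGLE.** Let `n` be even, `t` odd with `t + 1 ≤ n`; `u_U, v_M ∈ ℝ³` unit vectors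
with `u_U ⊥ v_M` for EVERY tight pair of a `t`-cut and a matching; `x, y ∈ [0,1]` weights with `x` supported on the `t`-cuts; and `W` any weight whose
tight `[0,1]`-rectangles are bounded by `γ` (`TracialValueLEAt W γ 1`). Then `Σ_U Σ_M W(U,M)·x_U y_M ⟨u_U, v_M⟩² ≤ γ` — the value of the rank-one
psd strategy `X_U = x_U u_U u_Uᵀ`, `Y_M = y_M v_M v_Mᵀ` of dimension 3. [cite: Rothvoss2017, §2 (PDF p. 6)] [cite: BrietDadushPokutta2014, Thm. 6 (§3)] -/
theorem exact_rankOne_dim_three_le {t : ℕ} (hn : Even n) (ht : Odd t) (htn : t + 1 ≤ n)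
    (W : OddSet n → PMatch n → ℝ) (γ : ℝ) (hγ : TracialValueLEAt W γ 1)
    (x : OddSet n → ℝ) (y : PMatch n → ℝ) (hx : ∀ U, 0 ≤ x U ∧ x U ≤ 1) (hy : ∀ M, 0 ≤ y M ∧ y M ≤ 1)
    (hxt : ∀ U, U.1.card ≠ t → x U = 0)
    (u : OddSet n → Fin 3 → ℝ) (v : PMatch n → Fin 3 → ℝ) (hu : ∀ U, u U ⬝ᵥ u U = 1) (hv : ∀ M, v M ⬝ᵥ v M = 1)
    (horth : ∀ U M, U.1.card = t → cc U M = 1 → u U ⬝ᵥ v M = 0) :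
    ∑ U, ∑ M, W U M * (x U * y M * (u U ⬝ᵥ v M) ^ 2) ≤ γ := by
  classical
  have hrect := (tracialValueLEAt_one_iff W γ).1 hγ
  -- it suffices to FACTORISE the kernel on the `t`-cuts through `[0,1]`-weights
  suffices hfac : ∃ f : OddSet n → ℝ, ∃ g : PMatch n → ℝ, (∀ U, 0 ≤ f U ∧ f U ≤ 1) ∧ (∀ M, 0 ≤ g M ∧ g M ≤ 1) ∧
      ∀ U M, U.1.card = t → (u U ⬝ᵥ v M) ^ 2 = f U * g M by
    obtain ⟨f, g, hf, hg, hfg⟩ := hfac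
    have heq : ∑ U, ∑ M, W U M * (x U * y M * (u U ⬝ᵥ v M) ^ 2) = ∑ U, ∑ M, W U M * ((x U * f U) * (y M * g M)) := by
      refine sum_congr rfl fun U _ => sum_congr rfl fun M _ => ?_
      by_cases hU : U.1.card = t
      · rw [hfg U M hU]; ring
      · rw [hxt U hU]; ring
    rw [heq]
    obtain ⟨A, B, hAB, hle⟩ := sum_box_le_rectangle W (fun U M => cc U M = 1) (fun U => x U * f U) (fun M => y M * g M)
      (fun U => ⟨mul_nonneg (hx U).1 (hf U).1, mul_le_one₀ (hx U).2 (hf U).1 (hf U).2⟩)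
      (fun M => ⟨mul_nonneg (hy M).1 (hg M).1, mul_le_one₀ (hy M).2 (hg M).1 (hg M).2⟩)
      (fun U M hUM => by
        by_cases hU : U.1.card = t
        · have h0 : f U * g M = 0 := by rw [← hfg U M hU, horth U M hU hUM]; ring
          calc x U * f U * (y M * g M) = x U * y M * (f U * g M) := by ring
            _ = 0 := by rw [h0, mul_zero]
        · show x U * f U * (y M * g M) = 0
          rw [hxt U hU]; ring)
    exact hle.trans (hrect A B hAB)
  -- the trivial factorisation when the kernel vanishes on the `t`-cuts
  have htriv : (∀ U M, U.1.card = t → u U ⬝ᵥ v M = 0) → ∃ f : OddSet n → ℝ, ∃ g : PMatch n → ℝ,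
      (∀ U, 0 ≤ f U ∧ f U ≤ 1) ∧ (∀ M, 0 ≤ g M ∧ g M ≤ 1) ∧ ∀ U M, U.1.card = t → (u U ⬝ᵥ v M) ^ 2 = f U * g M := fun h0 =>
    ⟨fun _ => 0, fun _ => 0, fun _ => ⟨le_rfl, zero_le_one⟩, fun _ => ⟨le_rfl, zero_le_one⟩, fun U M hU => by rw [h0 U M hU]; ring⟩
  -- CASE 1: all `t`-cut labels are parallel ⇒ the kernel vanishes (every matching has a tight `t`-cut)
  by_cases hpar : ∀ U U' : OddSet n, U.1.card = t → U'.1.card = t → vecMulVec (u U) (u U) = vecMulVec (u U') (u U')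
  · refine htriv fun U M hU => ?_
    obtain ⟨U₀, hU₀, hcc⟩ := exists_tight_cut ht htn M
    have h0 : (u U ⬝ᵥ v M) ^ 2 = 0 := by
      rw [dot_sq_eq_vecMulVec, hpar U U₀ hU hU₀, ← dot_sq_eq_vecMulVec, horth U₀ M hU₀ hcc]; ring
    exact pow_eq_zero_iff (two_ne_zero) |>.1 h0
  -- CASE 2: two ADJACENT `t`-cuts with independent labels (Johnson connectivity)
  have hadj : ∃ U₁ U₂ : OddSet n, U₁.1.card = t ∧ U₂.1.card = t ∧ (U₁.1 ∩ U₂.1).card + 1 = t ∧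
      vecMulVec (u U₁) (u U₁) ≠ vecMulVec (u U₂) (u U₂) := by
    by_contra hno
    push Not at hno
    exact hpar (eq_of_forall_adjacent (fun U => vecMulVec (u U) (u U)) fun U U' hU hU' hUU' => hno U U' hU hU' hUU')
  obtain ⟨U₁, U₂, hU₁, hU₂, hadj12, hne12⟩ := hadj
  set Wset : Finset (Fin n) := U₁.1 ∩ U₂.1 with hWset
  have hWcard : U₁.1.card = Wset.card + 1 := by rw [hU₁, ← hadj12]
  have hWcard' : U₂.1.card = Wset.card + 1 := by rw [hU₂, ← hadj12]
  have hWeven : Even Wset.card := by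
    obtain ⟨k, hk⟩ := ht
    exact ⟨k, by omega⟩
  set p : Fin 3 → ℝ := u U₁ ⨯₃ u U₂ with hpdef
  have hp : p ⬝ᵥ p ≠ 0 := cross_dot_cross_ne_zero (hu U₁) (hu U₂) hne12
  -- (ii) every matching splitting along `W = U₁ ∩ U₂` is labelled by `p`
  have hsplit : ∀ M : PMatch n, crossCount Wset M.1 = 0 → (p ⬝ᵥ p) • v M = (v M ⬝ᵥ p) • p ∧ (v M ⬝ᵥ p) ^ 2 = p ⬝ᵥ p := by
    intro M h0
    have h1 : u U₁ ⬝ᵥ v M = 0 := horth U₁ M hU₁ (cc_eq_one_of_upper h0 inter_subset_left hWcard)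
    have h2 : u U₂ ⬝ᵥ v M = 0 := horth U₂ M hU₂ (cc_eq_one_of_upper h0 inter_subset_right hWcard')
    rw [dotProduct_comm] at h1 h2
    obtain ⟨h3, h4⟩ := smul_eq_smul_of_cross_eq_zero (cross_eq_zero_of_orth h1 h2)
    exact ⟨h3, by rw [h4, hv M, one_mul]⟩
  -- (iii) PLANARITY: every `t`-cut label is orthogonal to `p`
  have hplane : ∀ U : OddSet n, U.1.card = t → u U ⬝ᵥ p = 0 := by
    intro U hU
    obtain ⟨M, hM0, hcc⟩ := exists_split_tight_cut hn hWeven U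
    obtain ⟨h3, h4⟩ := hsplit M hM0
    have h5 := congrArg (fun w => u U ⬝ᵥ w) h3
    simp only [dotProduct_smul, smul_eq_mul] at h5
    rw [horth U M hU hcc, mul_zero] at h5
    -- `0 = (v⬝p)(u⬝p)` with `(v⬝p)² = p⬝p ≠ 0`
    have hvp : v M ⬝ᵥ p ≠ 0 := fun h => hp (by rw [← h4, h]; ring)
    exact (mul_eq_zero.1 h5.symm).resolve_left hvp
  -- (iv) a matching `M` and a tight `t`-cut `U`: `u_U` is parallel to `q_M = v_M × p`
  have hq : ∀ (U : OddSet n) (M : PMatch n), U.1.card = t → cc U M = 1 →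
      ((v M ⨯₃ p) ⬝ᵥ (v M ⨯₃ p)) • u U = (u U ⬝ᵥ (v M ⨯₃ p)) • (v M ⨯₃ p) ∧ (u U ⬝ᵥ (v M ⨯₃ p)) ^ 2 = (v M ⨯₃ p) ⬝ᵥ (v M ⨯₃ p) := by
    intro U M hU hcc
    obtain ⟨h3, h4⟩ := smul_eq_smul_of_cross_eq_zero (cross_eq_zero_of_orth (horth U M hU hcc) (hplane U hU))
    exact ⟨h3, by rw [h4, hu U, one_mul]⟩
  -- CASE 2a: every matching label is parallel to `p` ⇒ the kernel vanishes on the `t`-cuts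
  by_cases hR : ∀ M : PMatch n, (v M ⨯₃ p) ⬝ᵥ (v M ⨯₃ p) = 0
  · refine htriv fun U M hU => ?_
    have h0 : v M ⨯₃ p = 0 := dotProduct_self_eq_zero.1 (hR M)
    obtain ⟨h3, -⟩ := smul_eq_smul_of_cross_eq_zero h0
    have h5 := congrArg (fun w => u U ⬝ᵥ w) h3
    simp only [dotProduct_smul, smul_eq_mul] at h5
    rw [hplane U hU, mul_zero] at h5
    exact (mul_eq_zero.1 h5).resolve_left hp
  -- CASE 2b: some `M*` has `q* = v_{M*} × p ≠ 0`; let `ℓ₀` be the label of a tight `t`-cut of `M*`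
  push Not at hR
  obtain ⟨Ms, hMs⟩ := hR
  obtain ⟨Us, hUs, hccs⟩ := exists_tight_cut ht htn Ms
  set ℓ₀ : Fin 3 → ℝ := u Us with hℓ₀
  have hℓ₀1 : ℓ₀ ⬝ᵥ ℓ₀ = 1 := hu Us
  have hpℓ₀ : p ⬝ᵥ ℓ₀ = 0 := by rw [dotProduct_comm]; exact hplane Us hUs
  -- (v) every matching label is orthogonal to `ℓ₀` (common tight cut with `M*`, brick 74)
  have hvℓ₀ : ∀ M : PMatch n, v M ⬝ᵥ ℓ₀ = 0 := by
    intro M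
    obtain ⟨U, hU, hccM, hccMs⟩ := exists_common_tight_cut ht htn M Ms
    -- `u_U ∥ q*` and `v_M ⊥ u_U`, hence `v_M ⊥ q*`
    obtain ⟨hE2, hE2'⟩ := hq U Ms hU hccMs
    have huq : u U ⬝ᵥ (v Ms ⨯₃ p) ≠ 0 := fun h => hMs (by rw [← hE2', h]; ring)
    have h6 := congrArg (fun w => v M ⬝ᵥ w) hE2
    simp only [dotProduct_smul, smul_eq_mul] at h6
    rw [dotProduct_comm (v M) (u U), horth U M hU hccM, mul_zero] at h6
    have hvq : v M ⬝ᵥ (v Ms ⨯₃ p) = 0 := (mul_eq_zero.1 h6.symm).resolve_left huq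
    -- `ℓ₀ ∥ q*`
    obtain ⟨hE1, -⟩ := hq Us Ms hUs hccs
    have h7 := congrArg (fun w => v M ⬝ᵥ w) hE1
    simp only [dotProduct_smul, smul_eq_mul] at h7
    rw [hvq, mul_zero] at h7
    exact (mul_eq_zero.1 h7).resolve_left hMs
  -- (vi) FACTORISATION through `m = p × ℓ₀`
  set m : Fin 3 → ℝ := p ⨯₃ ℓ₀ with hm
  have hmm : m ⬝ᵥ m = p ⬝ᵥ p := by
    rw [hm, cross_dot_cross, hpℓ₀, hℓ₀1, dotProduct_comm ℓ₀ p, hpℓ₀]; ring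
  have hp0 : 0 < p ⬝ᵥ p := lt_of_le_of_ne (Finset.sum_nonneg fun i _ => mul_self_nonneg (p i)) (Ne.symm hp)
  -- Cauchy–Schwarz in `ℝ³` via Lagrange's identity (cf. `Literature.Geometry.Riemannian.HamiltonODE.dot_sq_le`)
  have hCS : ∀ a b : Fin 3 → ℝ, (a ⬝ᵥ b) ^ 2 ≤ (a ⬝ᵥ a) * (b ⬝ᵥ b) := fun a b => by
    have h : 0 ≤ (a ⨯₃ b) ⬝ᵥ (a ⨯₃ b) := Finset.sum_nonneg fun i _ => mul_self_nonneg ((a ⨯₃ b) i)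
    rw [cross_dot_cross, dotProduct_comm b a] at h
    nlinarith [h]
  refine ⟨fun U => (u U ⬝ᵥ m) ^ 2 / (p ⬝ᵥ p), fun M => (v M ⬝ᵥ m) ^ 2 / (p ⬝ᵥ p), fun U => ⟨by positivity, ?_⟩, fun M => ⟨by positivity, ?_⟩,
    fun U M hU => ?_⟩
  · rw [div_le_one hp0, ← hmm]
    have h := hCS (u U) m
    rwa [hu U, one_mul] at h
  · rw [div_le_one hp0, ← hmm]
    have h := hCS (v M) m
    rwa [hv M, one_mul] at h
  · have hid := dot_mul_eq_of_orth (hplane U hU) (hvℓ₀ M) hpℓ₀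
    rw [hℓ₀1, mul_one, ← hm] at hid
    have hid2 : ((u U ⬝ᵥ v M) * (p ⬝ᵥ p)) ^ 2 = ((u U ⬝ᵥ m) * (v M ⬝ᵥ m)) ^ 2 := by rw [hid]
    rw [div_mul_div_comm, eq_div_iff (mul_pos hp0 hp0).ne']
    linear_combination hid2

end Exact

/-! ### §3 Matrix form (appended): the value of the rank-one psd strategy -/

section MatrixForm

variable {n : ℕ}

/-- `tr((x·uuᵀ)(y·vvᵀ)) = x y ⟨u,v⟩²`. -/
theorem trace_rankOne_mul_rankOne {r : ℕ} (x y : ℝ) (u v : Fin r → ℝ) :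
    ((x • vecMulVec u u) * (y • vecMulVec v v)).trace = x * y * (u ⬝ᵥ v) ^ 2 := by
  rw [smul_mul_assoc, mul_smul_comm, vecMulVec_mul_vecMulVec, trace_smul, trace_smul, vecMulVec_smul, trace_smul, trace_vecMulVec]
  simp only [smul_eq_mul]
  ring

/-- **Matrix form of `exact_rankOne_dim_three_le`.** For the rank-one strategy `X_U = x_U·u_U u_Uᵀ`, `Y_M = y_M·v_M v_Mᵀ` in dimension `3` with an EXACT
labelling (`u_U ⊥ v_M` on every tight pair of a `t`-cut), any weight `W` with `TracialValueLEAt W γ 1` has `Σ_U Σ_M W(U,M)·tr(X_U Y_M) ≤ γ`, hence normalised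
value `≤ γ/3`. (No `IsPsdRect` hypothesis is needed beyond the labelling data; for `x, y ∈ [0,1]` and unit `u, v` the strategy IS a tight psd rectangle.)
[cite: Rothvoss2017, §2 (PDF p. 6)] [cite: BrietDadushPokutta2014, Thm. 6 (§3)] -/
theorem exact_rankOne_dim_three_trace_le {t : ℕ} (hn : Even n) (ht : Odd t) (htn : t + 1 ≤ n)
    (W : OddSet n → PMatch n → ℝ) (γ : ℝ) (hγ : TracialValueLEAt W γ 1)
    (x : OddSet n → ℝ) (y : PMatch n → ℝ) (hx : ∀ U, 0 ≤ x U ∧ x U ≤ 1) (hy : ∀ M, 0 ≤ y M ∧ y M ≤ 1)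
    (hxt : ∀ U, U.1.card ≠ t → x U = 0)
    (u : OddSet n → Fin 3 → ℝ) (v : PMatch n → Fin 3 → ℝ) (hu : ∀ U, u U ⬝ᵥ u U = 1) (hv : ∀ M, v M ⬝ᵥ v M = 1)
    (horth : ∀ U M, U.1.card = t → cc U M = 1 → u U ⬝ᵥ v M = 0)
    (X : OddSet n → Matrix (Fin 3) (Fin 3) ℝ) (Y : PMatch n → Matrix (Fin 3) (Fin 3) ℝ)
    (hX : ∀ U, X U = x U • vecMulVec (u U) (u U)) (hY : ∀ M, Y M = y M • vecMulVec (v M) (v M)) :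
    ∑ U, ∑ M, W U M * (X U * Y M).trace ≤ γ ∧ (∑ U, ∑ M, W U M * (X U * Y M).trace) / 3 ≤ γ / 3 := by
  have h : ∑ U, ∑ M, W U M * (X U * Y M).trace = ∑ U, ∑ M, W U M * (x U * y M * (u U ⬝ᵥ v M) ^ 2) :=
    sum_congr rfl fun U _ => sum_congr rfl fun M _ => by rw [hX U, hY M, trace_rankOne_mul_rankOne]
  have hle := exact_rankOne_dim_three_le hn ht htn W γ hγ x y hx hy hxt u v hu hv horth
  rw [h]
  exact ⟨hle, by linarith⟩

end MatrixForm

end Summit.PneNP.PneNP.Theorems.ChebyshevTracialDesignExactDimThree
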